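import Summits.Ventures.HSemireg.SheafSeedOnAnchor
import Literature.AlgebraicGeometry.HodgeTheory.SemiregularityMapDinatural

/-!
# B4DoorCount v1.1 — the φ-FREE DOOR COUNT and the SPLIT SCREEN on the B₄ × B̄₄ frame (row Σ-EMBED, plan-lens-HodgeAV-embed-2 g2, 2026-08-29)

Nothing here proves HC, HC_AV, HC_CM, H2 or 18881; census-neutral; no fact, no instance, no notation, no axiom. SORRY-FREE.
Pen derivation + machine table: `Cruxes/BlochSeedDiscOne/DOOR-COUNT-EMBED-embed2-g2.md` (engine v1.1 `bframe3/doorcount.py` 4df336401eb4c3d9, table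
`bframe3/door_all41.json` 4b56e4103c341d81 — all 41 designs of record of the two embed HOMEs, stdlib python, exact integer arithmetic over ℤ[ζ₁₆]; every
number below is reproduced there; v1.0 table `door_all.json` 43c136663f4e6cb6 = the first 38).

NODE (D-0171), successor of `B4ClassGate.lean` (g0) for the SAME room target: «a finite locally free `I`-semiregular sheaf on P = B₄ × B̄₄ (hyperbolic,
K = ℚ(i), ψ₀² = −1) realising a clean class with Weil part ≠ 0 ⟹ `HasLocallyAlgebraicWeilAnchor 4 1` through the BF-model door». ROOT = `Target` :=
`HasLocallyAlgebraicWeilAnchor 4 1` (the d = 1 anchor currency; NOT `BlochSeedDiscOne` = `HasHyperbolicBlochSeed 4 1` itself — this is a crux WORKFILE of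
18881, not a line on it). `closes : PrintBF51Model → EmbedSheafSeed C → Target` is the tree door re-displayed (§1). The node is ONE-DIRECTIONAL
(Target does not give back a sheaf seed), so no EQUIV obligation; the child of `EmbedSheafSeed` is nevertheless displayed (§0 below) because that is
where the room's content lives.

## §0 The child of `EmbedSheafSeed C` on the embed frame (pen ∕ machine; pieces and leaves TAGGED)

Frame (embed g0 memo `B4-PRESENTATION-embed-g0.md` v1 §1, dictionary (π)): P = B₄ × B̄₄, B₄ the simple CM fourfold of type (ℚ(ζ₁₆), {1,3,5,9}), letters
L_x = L(H_x, χ_x) = Hermitian matrices x = [[a₁, β],[β̄, a₂]] (a_i ∈ 𝒪_{L₀} totally in [0,H], β ∈ 𝒪_L) — BOX-H alphabets (689 letters at H = 4, 3940 at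
H = 5); a DESIGN ν ∈ ℤ^{letters} is CLEAN if ch(Σ ν_x [L_x]) ∈ ℚ[h] ⊕ W_K, with Weil charge λ(ν) and h-coordinates Q₀(ν) … Q₈(ν). The ROADS to
`EmbedSheafSeed C` (an `I`-semiregular finite locally free ℰ₀ ON P with ch₄ = q·h⁴ + w, w ≠ 0, ch_p = c_p hᵖ for p ∈ I ∖ {4}, 4 ∈ I):

* ROAD LB2 — TWO-TERM LINE-BUNDLE DISPLAYS `0 → K → 𝓐 := ⊕_{ν_x > 0} L_x^{ν_x} ⊕ 𝒪^{m_O} —φ→ 𝓑 := ⊕_{ν_y < 0} L_y^{|ν_y|} → 0`, ℰ₀ := K = ker φ. AND-screens: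
  - (S1) CLASS GATE c₅ = … = c₈ = 0 at rank 4 — WEAKER than the target, DECIDED: PASS (g0 `B4ClassGate.nu4_gate`; integer gate OBJECTS p (BOX-4, 264
    letters) and p₅′ (BOX-5, 316 letters), `B4GateObject.lean`, `B5GateObject.lean`).
  - (S2) DISPLAY HONESTY (surjectivity of φ: sources for every 𝓑-letter, no base points) — WEAKER; BOX-4: DECIDED = BARRIER (road verdict (L) 272 < (G) 336,
    `B4RoadGate.lean`, memo `B4-DISPLAY-ROAD-embed2-g0.md` v1.2); BOX-5: UNDECIDED — H1 infeasible on 5∕5 fixed sign partitions, the role-MIP «B5-FIBRE»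
    staged (`bframe2/box5mip_{re,im,zero}.lp`, 1 582 binaries) = INSTRUMENTABLE (successor PREREG, memo §6).
  - (S3) **SPLIT SCREEN (new, §3, kernel BY NAME)**: an 𝓐-letter x with NO live arrow (no y ∈ 𝓑 with y − x positive semidefinite) has φ|_{L_x^{ν_x}} = 0, so
    L_x^{ν_x} is a direct summand of K; if ν_x ≥ 2 then K ≅ L_x ⊞ (L_x ⊞ K′) and `Ext²(L_x, L_x ⊞ K′) ⊇ H²(𝒪_P) = ℂ²⁸ ≠ 0`, so K is NOT `I`-semiregular for
    ANY `I` (`splitScreen` ∕ `not_isISemiregular_of_cross_ext_ne_zero`, from the tree's `IsISemiregular.eq_zero_of_biprod₁₂` = BF Cor. 4.8 consequence).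
    MACHINE (`door_all.json`): the BOX-5 objects p₅ ∕ p₅′ have 47 ∕ 75 such letters, every BOX-5 LP∕gate design of record 47–112, D144 and the BOX-4 sign-LP
    vertices 16–70, ν₁₆ 16; the BOX-4 HONEST∕GATE designs and the object p have 0 (there honesty is what fails, (S2)). TAG: WEAKER, DECIDED = DEAD on every
    BOX-5 design of record; as a constraint («every 𝓐-letter of multiplicity ≥ 2 has a live arrow») it is LINEAR in the role binaries ⟹ INSTRUMENTABLE
    (B5-FIBRE v2, memo §6).
  - (S4) **DOOR COUNT (new, §2 + §4, pen (F1)–(F4) of `C4-EXT2-COUNT-c4-1-g5.md` ported to the embed frame WITHOUT Künneth multidegree)**: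
    `I`-semiregularity of ℰ₀ needs `ext²(ℰ₀,ℰ₀) ≤ doorCeiling I′ ≤ 8008` (`doorCeiling_le`; 5 572 for the door of record I = {1,2,3,4}, `doorCeiling_record`),
    while for a two-term display `ext²(K,K) ≥ dim E₂^{0,2}` (column 0 of the spectral sequence of Hom•(K•,K•) is final) and `dim E₂^{0,2} ≥
    max((B0+), (B1rig))`. **(B0+) = the NULL-FREE DIAGONAL FLOOR (flow-free, (H-rig)-free, `diagonal_floor` is its linear-algebra skeleton)**:
    `28·Σ_{s null-free} m_s² + max(0, 28·Σ_{s null-touching} m_s² − 6·Σ_{x→y live, y−x of rank 1} |χ_Y(y−x)|·m_x m_y)` — the diagonal End-blocks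
    `H²(𝒪_P)^{m_s²}` emit ONLY along NULL live arrows (h²(L_{y−x}) = 0 on every non-degenerate live arrow) and the incoming differential `d⁻` has ZERO
    component in every diagonal block (a component needs `x→y` live AND `h²(L_{x−y}) > 0`, impossible: `x − y` is then negative semidefinite ≠ 0), so
    `ker(d|Diag)` injects into `E₂^{0,2}`. DESIGN-FREE COROLLARY (pen, memo §3.4): in ANY two-term line-bundle display with `I`-semiregular kernel on an
    abelian eightfold, the letters WITHOUT a null live arrow carry `Σ m_s² ≤ ⌊doorCeiling∕28⌋ = 286` (199 for the door of record, 112 for `I = {4}`;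
    `door_floor_div`). (B1rig) = the weighted-König ∕ max-flow deficiency of all same-side H²-blocks of non-degenerate index-2 type minus the König bound
    on the incoming image (`e2_count` is the rank–nullity skeleton; the cover step is Lovász–Plummer) — a refinement, never needed for the verdicts.
    MACHINE: **41∕41 designs of record DOOR-DEAD by (B0+) alone** (37∕41 already by the bare null-free floor 28·Σ_{null-free} m²), bound∕Σm² ∈
    [12.5, 50.3]; objects p: 5.78·10⁵⁹, p₅: 2.25·10⁵⁸ ((B0+) 8.66·10⁵⁶), p₅′: 1.71·10⁶², D144 (×11 910): 361 858 384 ((B0+) 339 748 848), ν₁₆: 11 200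
    (`door_nu16`, `door_D144`, `door_p5`) — against 8 008. TAG: WEAKER, DECIDED = DEAD on the designs of record; the complement «a clean λ ≠ 0 gate design
    with (B0+) ≤ 8 008» (every null-free letter of multiplicity ≤ 16, at most 286 of them, and the null-touching mass absorbed by null arrows) is
    INSTRUMENTABLE (door-aware MIQP ∕ role-MIP constraints, memo §6); a fully design-free Σ-FLOOR on B₄ × B̄₄ (no null-free proviso) is IDEA-NEEDED.
  VERDICT FOR THE ROAD: every two-term address in circulation (BOX-4 and BOX-5, honest or not; 41 designs) is DEAD twice over ((S3) or (S2), and (S4));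
  the road itself stays open only in the sparse corner {null-free mass ≤ 286, null-touching mass absorbed, every multiple 𝓐-letter live, honest, gate} —
  BARRIER-grade evidence plus one design-free necessary condition, not a closing theorem.
* ROAD NS — NON-SPLIT presentations (monads L• of length ≥ 2, extensions): column 0 is no longer final, (S3)∕(S4) weaken to the c4-1 (F2) form; IDEA-NEEDED
  (seats monad4 `B3-MONAD-COHOMOLOGY-monad4-g2.md`, c4-1).
* ROAD SH — ONE (semi)homogeneous ∕ simple bundle (Mukai): ch = r·exp(δ∕r) is a LINE-type class, class-dead on B₄ × B̄₄ at every height (embed g0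
  `SIMPLE-CM-ANCHOR-embed-g0.md` v1.4 §0.4 Lemma B): BARRIER (class level).
No piece is COSTUME: none restates 18881, H2 or the anchor. Hypothesis (H-rig) (descended rank-1 letters carry the trivial character on the kernel torus,
memo rule (H)) enters ONLY (B1) («under (H-rig)» column of the table), never (B0), (B1rig), (S3).

## What is kernel-checked here
§1 `closes` (tree door by name); §2 `doorCeiling`, `doorCeiling_record = 5572`, `doorCeiling_full = 8008`, `doorCeiling_single = 3136`, `doorCeiling_le`
(every I′), `door_floor_div` (286 ∕ 199 ∕ 112); §3 `splitScreen`, `not_isISemiregular_of_cross_ext_ne_zero` (BF Cor. 4.8 consequence, by name); §4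
`finrank_le_finrank_ker_add`, `e2_count` (rank–nullity skeleton of (F3)), `diagonal_floor` (skeleton of (B0+): `D ≤ ker d`, `D ⊓ im d⁻ = ⊥` ⟹
`dim D + rk d⁻ ≤ dim ker d`); §5 the (B0) law as an integer function and the headline certificates. INSTRUMENT DATA: `bframe3/doorcount.py` (v1.1),
`bframe3/door_all41.json`, `bframe3/floor00.py`, `bframe3/nu16coords.py` (ν₁₆ is a PURE Weil class: Q₀ = … = Q₈ = 0, λ = 128i — gate-dead at every scale).
-/

noncomputable section

open CategoryTheory CategoryTheory.Limits AlgebraicGeometry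

namespace Summit.HodgeConjecture.HodgeConjecture.Cruxes.BlochSeedDiscOne.B4DoorCount

open Literature.AlgebraicGeometry Literature.AlgebraicGeometry.Modules Literature.AlgebraicGeometry.Motives
open Literature.AlgebraicGeometry.HodgeTheory
open Summit.Ventures.HSemireg

/-! ## §1 Root, pieces, `closes` -/

/-- ROOT of the node = the room target: the `d = 1`, `n = 4` locally algebraic hyperbolic Weil anchor. -/
abbrev Target : Prop := HasLocallyAlgebraicWeilAnchor 4 1

/-- Piece P — PRINT-BY-NAME leaf (refereed named fact, route input): Buchweitz–Flenner Thm. 5.1 in its model rendering.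
[cite: BuchweitzFlenner2003, §5 Thm. 5.1] -/
abbrev PrintBF51Model : Prop := BuchweitzFlenner2003_variationalHodge_ISemiregular_model

/-- Piece E — UNDECIDED (the cell's computation target on the embed frame): for the Chern character theory `C`, SOME index set `I` carries a
hyperbolic one-model Buchweitz–Flenner sheaf seed at `(N, d) = (4, 1)` — an `I`-semiregular finite locally free `ℰ₀` ON a split `ℚ(i)`-Weil
eightfold with `ch₄(ℰ₀) = q·h⁴ + w`, `w ≠ 0` a rational Weil class, `ch_p(ℰ₀) = c_p·hᵖ` (`p ∈ I`, `p ≠ 4`). Its child is §0 of the module docstring.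
[cite: BuchweitzFlenner2003, §5 (I-semiregular)] -/
def EmbedSheafSeed (C : ChernCharacterBetti) : Prop := ∃ I : Finset ℕ, HasHyperbolicBFSheafSeedOn C 4 1 I

/-- **`closes`: Target ⟸ P ∧ E** — the tree door `hasLocallyAlgebraicWeilAnchor_of_BFmodel_of_hyperbolicBFSheafSeedOn` at `(4, 1)`.
[cite: BuchweitzFlenner2003, §5 Thm. 5.1] [cite: Deligne1982HodgeCycles, proof of Thm. 4.8] -/
theorem closes (C : ChernCharacterBetti) (hP : PrintBF51Model) (hE : EmbedSheafSeed C) : Target := by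
  obtain ⟨I, hS⟩ := hE
  exact hasLocallyAlgebraicWeilAnchor_of_BFmodel_of_hyperbolicBFSheafSeedOn hP hS

/-! ## §2 The door ceiling: `ext² ≤ Σ_{q ∈ I′} h^{q, q+2}(P)` on an abelian eightfold (`h^{p,q} = C(8,p)·C(8,q)`) -/

/-- The dimension of the target of the `I′`-part of the semiregularity map on an abelian EIGHTFOLD: `Σ_{q ∈ I′} C(8,q)·C(8,q+2)`
(`I′ = {q | q + 1 ∈ I}` in the tree's numbering). Joint injectivity of `(σ_q)_{q ∈ I′}` on `Ext²(ℰ₀,ℰ₀)` needs `ext² ≤ doorCeiling I′`. -/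
def doorCeiling (I' : Finset ℕ) : ℕ := I'.sum fun q => Nat.choose 8 q * Nat.choose 8 (q + 2)

/-- Door of record `I = {1,2,3,4}` (`I′ = {0,1,2,3}`): 28 + 448 + 1960 + 3136 = 5572. -/
theorem doorCeiling_record : doorCeiling (Finset.range 4) = 5572 := by decide

/-- The widest door (`I′ = {0,…,6}`): 8008 (`= C(16,6)`, Vandermonde). -/
theorem doorCeiling_full : doorCeiling (Finset.range 7) = 8008 := by decide

/-- The single-component door `I = {4}` (`I′ = {3}`): `h^{3,5} = 3136`. -/
theorem doorCeiling_single : doorCeiling {3} = 3136 := by decide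

/-- The design-free null-free mass ceilings `⌊door∕28⌋` (28 = h^{0,2}(P) = dim H²(𝒪_P) per unit of m²): 286, 199, 112. -/
theorem door_floor_div : 8008 / 28 = 286 ∧ 5572 / 28 = 199 ∧ 3136 / 28 = 112 ∧ 28 * 287 > 8008 ∧ 28 * 17 ^ 2 > 8008 := by decide

/-- **Every door is at most 8008 wide**: the terms with `q ≥ 7` vanish (`C(8, q+2) = 0`). -/
theorem doorCeiling_le (I' : Finset ℕ) : doorCeiling I' ≤ 8008 := by
  classical
  have hzero : ((I'.filter fun q => ¬ q < 7).sum fun q => Nat.choose 8 q * Nat.choose 8 (q + 2)) = 0 := by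
    refine Finset.sum_eq_zero fun q hq => ?_
    rw [Finset.mem_filter] at hq
    rw [Nat.choose_eq_zero_of_lt (by omega : 8 < q + 2), Nat.mul_zero]
  have hsplit : doorCeiling I' = (I'.filter fun q => q < 7).sum fun q => Nat.choose 8 q * Nat.choose 8 (q + 2) := by
    unfold doorCeiling
    rw [← Finset.sum_filter_add_sum_filter_not I' (fun q => q < 7), hzero, Nat.add_zero]
  rw [hsplit, ← doorCeiling_full]
  unfold doorCeiling
  refine Finset.sum_le_sum_of_subset_of_nonneg (fun q hq => ?_) (fun _ _ _ => Nat.zero_le _)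
  rw [Finset.mem_filter] at hq
  exact Finset.mem_range.2 hq.2

/-! ## §3 The SPLIT SCREEN, kernel form: a non-zero cross class `Ext²(E₁, E₂)` forbids `I`-semiregularity of `E₁ ⊞ E₂` for EVERY `I` -/

universe u

variable {S : Type u} [CommRing S] {X : Over (Spec (CommRingCat.of S))} {E₁ E₂ : X.left.Modules}

/-- **SPLIT SCREEN.** If `E₁ ⊞ E₂` is `I`-semiregular then every `y ∈ Ext²(E₁, E₂)` vanishes (tree: `IsISemiregular.eq_zero_of_biprod₁₂`, a
consequence of BF Cor. 4.8); so a NON-ZERO cross class is a contradiction. Used with `E₁ = L_x`, `E₂ = L_x ⊞ K′` (an 𝓐-letter of multiplicity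
`≥ 2` without live arrows), where `Ext²(L_x, L_x ⊞ K′) ⊇ Ext²(L_x, L_x) = H²(𝒪_P) ≅ ℂ²⁸`. [cite: BuchweitzFlenner2003, Cor. 4.8 (consequence) and §5] -/
theorem splitScreen {hB : IsFiniteLocallyFree (E₁ ⊞ E₂)} {I : Set ℕ} (h : IsISemiregular hB I)
    (hE₂ : IsFiniteLocallyFree E₂) (y : Abelian.Ext E₁ E₂ 2) (hy : y ≠ 0) : False :=
  hy (h.eq_zero_of_biprod₁₂ hE₂ y)

/-- The screen as used: a non-zero `y ∈ Ext²(E₁, E₂)` makes `E₁ ⊞ E₂` non-`I`-semiregular for EVERY index set `I` (any proof `hB` of local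
freeness of the sum). [cite: BuchweitzFlenner2003, Cor. 4.8 (consequence) and §5] -/
theorem not_isISemiregular_of_cross_ext_ne_zero (hB : IsFiniteLocallyFree (E₁ ⊞ E₂)) (hE₂ : IsFiniteLocallyFree E₂)
    (y : Abelian.Ext E₁ E₂ 2) (hy : y ≠ 0) (I : Set ℕ) : ¬ IsISemiregular hB I :=
  fun h => splitScreen h hE₂ y hy

/-! ## §4 The rank–nullity skeleton of the door count (F3): `dim E₂^{0,2} ≥ dim E₁^{0,2} − dim E₁^{1,2} − dim E₁^{−1,2}` -/

/-- `dim V ≤ dim ker f + dim W` for a linear map `f : V → W` of finite-dimensional spaces. -/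
theorem finrank_le_finrank_ker_add {K V W : Type*} [DivisionRing K] [AddCommGroup V] [Module K V] [FiniteDimensional K V]
    [AddCommGroup W] [Module K W] [FiniteDimensional K W] (f : V →ₗ[K] W) :
    Module.finrank K V ≤ Module.finrank K (LinearMap.ker f) + Module.finrank K W := by
  have h1 := LinearMap.finrank_range_add_finrank_ker f
  have h2 : Module.finrank K (LinearMap.range f) ≤ Module.finrank K W := Submodule.finrank_le _
  omega

/-- **(F3), crude form.** For `U —d→ V —d′→ W` (the `H²` of `Hom⁻¹ → Hom⁰ → Hom¹` of a two-term display): the column-0 term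
`E₂^{0,2} = ker d′ / im d` has `dim ker d′ − dim im d ≥ dim V − dim W − dim U`. The König∕support-pattern refinements (B0), (B1) of the memo replace
`dim W`, `dim U` by weighted minimum vertex covers of the block pattern of `φ` (pen; Lovász–Plummer). -/
theorem e2_count {K U V W : Type*} [DivisionRing K] [AddCommGroup U] [Module K U] [FiniteDimensional K U] [AddCommGroup V]
    [Module K V] [FiniteDimensional K V] [AddCommGroup W] [Module K W] [FiniteDimensional K W]
    (d : U →ₗ[K] V) (d' : V →ₗ[K] W) :
    Module.finrank K V ≤ (Module.finrank K (LinearMap.ker d') - Module.finrank K (LinearMap.range d))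
      + Module.finrank K W + Module.finrank K U := by
  have h1 := LinearMap.finrank_range_add_finrank_ker d'
  have h2 : Module.finrank K (LinearMap.range d') ≤ Module.finrank K W := Submodule.finrank_le _
  have h3 : Module.finrank K (LinearMap.range d) ≤ Module.finrank K U := LinearMap.finrank_range_le d
  omega

/-- **(B0+) skeleton — the null-free diagonal floor.** If a subspace `D` of the column-0 term (the diagonal End-blocks the outgoing differential `d`
kills) lies in `ker d` and meets the incoming image `im d⁻` trivially (pen: `d⁻` has zero component in every diagonal block), then
`dim D + rk d⁻ ≤ dim ker d`, i.e. `dim E₂^{0,2} = dim ker d − rk d⁻ ≥ dim D`. -/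
theorem diagonal_floor {K U V W : Type*} [DivisionRing K] [AddCommGroup U] [Module K U] [AddCommGroup V] [Module K V]
    [FiniteDimensional K V] [AddCommGroup W] [Module K W] (d : V →ₗ[K] W) (dm : U →ₗ[K] V) (D : Submodule K V)
    (hD : D ≤ LinearMap.ker d) (hcx : LinearMap.range dm ≤ LinearMap.ker d) (hdisj : Disjoint D (LinearMap.range dm)) :
    Module.finrank K D + Module.finrank K (LinearMap.range dm) ≤ Module.finrank K (LinearMap.ker d) := by
  have h1 := Submodule.finrank_sup_add_finrank_inf_eq D (LinearMap.range dm)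
  have h2 : Module.finrank K ↥(D ⊓ LinearMap.range dm) = 0 := by
    rw [hdisj.eq_bot, finrank_bot]
  have h3 : Module.finrank K ↥(D ⊔ LinearMap.range dm) ≤ Module.finrank K (LinearMap.ker d) :=
    Submodule.finrank_mono (sup_le hD hcx)
  omega

/-! ## §5 The (B0) law and the headline certificates (numbers reproduced by `bframe3/doorcount.py`) -/

/-- **(B0)**, the diagonal door bound of a two-term display as an integer function of its two invariants: `mass2 = Σ_s m_s²` (all letters incl. the
𝒪-padding) and `nullAbs = 6·Σ_{x→y live, rank 1} |χ_Y(y − x)|·m_x·m_y` (the only `H²`-capacity the diagonal End-blocks can emit into). -/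
def b0 (mass2 nullAbs : ℕ) : ℤ := 28 * (mass2 : ℤ) - (nullAbs : ℤ)

/-- ν₁₆ (96 balanced letters (2,2;β), pure Weil class λ = 128i, padded by 𝒪⁴): Σm² = 400, no null live arrow — (B0) = 11200 > 8008. -/
theorem door_nu16 : b0 400 0 = 11200 ∧ (8008 : ℤ) < b0 400 0 := by norm_num [b0]

/-- D144 (embed g0's exact sign-LP vertex, ×11910, padded by 𝒪^1268): Σm² = 15 417 684, null absorption 91 946 304 — (B0) = 339 748 848 > 8008
((B1rig) = 361 858 384). -/
theorem door_D144 : b0 15417684 91946304 = 339748848 ∧ (8008 : ℤ) < b0 15417684 91946304 := by norm_num [b0]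

/-- The BOX-5 integer gate object p₅ (210 letters + 𝒪⁴): the crude (B0) < 0 is void there (heavy null arrows), but 110 of its 210 letters are
null-free with Σ m² = 30 941 378 342 319 996 200 738 482 114 494 882 198 547 507 838 348 960 000, so the null-free floor alone is 28× that =
8.66·10⁵⁶ > 8008 ((B1rig) = 2.25·10⁵⁸; and 47 split letters, §3). -/
theorem door_p5 :
    b0 902793319106578996991084421964603972064485746856846681616
        28367325234571624519733697887297267559241919289005495616000 < 0 ∧
      (8008 : ℤ) < b0 30941378342319996200738482114494882198547507838348960000 0 ∧
      (8008 : ℕ) < 22458640559886160697768855310743490205777183959191227776000 := by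
  refine ⟨by norm_num [b0], by norm_num [b0], by norm_num⟩

/-! ## Audit: nothing is decided here
`closes` has the seed `EmbedSheafSeed C` (OPEN) and the refereed fact `PrintBF51Model` among its hypotheses; §§2–5 are arithmetic ∕ linear algebra and a
by-name corollary of a Literature theorem. `HC_CM`, `BlochSeedDiscOne` do not occur. No new named fact; standard axioms only. -/

end Summit.HodgeConjecture.HodgeConjecture.Cruxes.BlochSeedDiscOne.B4DoorCount

end
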